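import Summits.Ventures.HodgeRepro2.T5Sl2LowestWeight

/-!
# «Weights bounded below» gives a lowest-weight vector

Tier-5 support (N4.3 = (R3), step (P2′): «Bargmann's list: weights bounded below starting at 3 ⇒
π₃⁺»; route/T5-SUPPORT-p1.md §S4.16).  The hypothesis of that printed sentence is «the
`SO(2)`-weights are integers bounded below»; this file shows, for an `sl₂`-triple `(h, e, f)`
acting on a module over a field of characteristic zero, that such a weight set produces a
lowest-weight vector in the sense of `T5Sl2LowestWeight`:

* `exists_hasLowestWeightVector_of_bddBelow`: if every `h`-eigenvalue is an integer, the set of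
  `h`-eigenvalues is non-empty and bounded below, then there is a lowest-weight vector, of weight
  the least eigenvalue (`Int.exists_least_of_bdd`; the eigenspace of `n₀ − 2` is `⊥`, so
  `hasLowestWeightVector_of_eigenspace_sub_two_eq_bot` applies);
* `exists_hasLowestWeightVector_of_least`: if `n₀` is an eigenvalue and no integer below it is,
  there is a lowest-weight vector of weight `n₀`; `exists_hasLowestWeightVector_three` for
  `n₀ = 3`.

Combined with `T5Sl2LowestWeight` / `T5Sl2LowestWeightUnique`: an irreducible module (triple
spanning) whose integer weights are bounded below with least weight `3` has weights exactly
`3, 5, 7, …`, each once, and is unique up to isomorphism — the algebraic content of the printed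
sentence; that `π₃⁺`'s `K`-finite vectors form such a module stays [C].

Blind lane: Mathlib + own prefix; no sorry; axioms ⊆ {propext, Classical.choice, Quot.sound}.
-/

namespace Summit.Ventures.HodgeRepro2.T5Sl2LowestWeightExists

open LieModule Module Summit.Ventures.HodgeRepro2.T5Sl2LowestWeight

variable {K L M : Type*} [Field K] [CharZero K] [LieRing L] [LieAlgebra K L]
  [AddCommGroup M] [Module K M] [LieRingModule L M] [LieModule K L M]
variable {h e f : L} (t : IsSl2Triple h e f)

/-- If `n₀` is an `h`-eigenvalue and no integer `< n₀` is, the eigenspace of `n₀ − 2` is `⊥`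
(given that every eigenvalue is an integer). -/
lemma eigenspace_least_sub_two_eq_bot (hint : ∀ c : K, (toEnd K L M h).HasEigenvalue c → ∃ n : ℤ, c = n)
    {n₀ : ℤ} (hleast : ∀ n : ℤ, (toEnd K L M h).HasEigenvalue (n : K) → n₀ ≤ n) :
    (toEnd K L M h).eigenspace ((n₀ : K) - 2) = ⊥ := by
  by_contra hne
  obtain ⟨m, hm⟩ := hint _ hne
  have hm' : (m : K) = ((n₀ - 2 : ℤ) : K) := by rw [← hm]; push_cast; ring
  have hmn : m = n₀ - 2 := Int.cast_injective hm'
  have := hleast m (by rw [← hm]; exact hne)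
  omega

/-- **«Weights bounded below» gives a lowest-weight vector**: if every `h`-eigenvalue is an
integer and the eigenvalues are non-empty and bounded below, there is a lowest-weight vector
whose weight is the least eigenvalue. -/
theorem exists_hasLowestWeightVector_of_bddBelow
    (hint : ∀ c : K, (toEnd K L M h).HasEigenvalue c → ∃ n : ℤ, c = n)
    (hbdd : ∃ b : ℤ, ∀ n : ℤ, (toEnd K L M h).HasEigenvalue (n : K) → b ≤ n)
    (hne : ∃ c : K, (toEnd K L M h).HasEigenvalue c) :
    ∃ (n₀ : ℤ) (m : M), HasLowestWeightVector t m (n₀ : K) ∧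
      (toEnd K L M h).HasEigenvalue (n₀ : K) ∧
      ∀ n : ℤ, (toEnd K L M h).HasEigenvalue (n : K) → n₀ ≤ n := by
  obtain ⟨b, hb⟩ := hbdd
  obtain ⟨c, hc⟩ := hne
  obtain ⟨n, rfl⟩ := hint c hc
  obtain ⟨n₀, hn₀, hleast⟩ :=
    Int.exists_least_of_bdd (P := fun n : ℤ => (toEnd K L M h).HasEigenvalue (n : K)) ⟨b, hb⟩
      ⟨n, hc⟩
  obtain ⟨m, hm⟩ := hn₀.exists_hasEigenvector
  exact ⟨n₀, m, hasLowestWeightVector_of_eigenspace_sub_two_eq_bot t hm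
    (eigenspace_least_sub_two_eq_bot hint hleast), hn₀, hleast⟩

/-- If `n₀` is an eigenvalue and no integer below it is, there is a lowest-weight vector of
weight `n₀`. -/
theorem exists_hasLowestWeightVector_of_least
    (hint : ∀ c : K, (toEnd K L M h).HasEigenvalue c → ∃ n : ℤ, c = n) {n₀ : ℤ}
    (hn₀ : (toEnd K L M h).HasEigenvalue (n₀ : K))
    (hleast : ∀ n : ℤ, (toEnd K L M h).HasEigenvalue (n : K) → n₀ ≤ n) :
    ∃ m : M, HasLowestWeightVector t m (n₀ : K) := by
  obtain ⟨m, hm⟩ := hn₀.exists_hasEigenvector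
  exact ⟨m, hasLowestWeightVector_of_eigenspace_sub_two_eq_bot t hm
    (eigenspace_least_sub_two_eq_bot hint hleast)⟩

/-- «Weights bounded below starting at `3`»: a lowest-weight vector of weight `3` exists. -/
theorem exists_hasLowestWeightVector_three
    (hint : ∀ c : K, (toEnd K L M h).HasEigenvalue c → ∃ n : ℤ, c = n)
    (h3 : (toEnd K L M h).HasEigenvalue (3 : K))
    (hleast : ∀ n : ℤ, (toEnd K L M h).HasEigenvalue (n : K) → 3 ≤ n) :
    ∃ m : M, HasLowestWeightVector t m (3 : K) := by
  obtain ⟨m, hm⟩ := exists_hasLowestWeightVector_of_least t hint (n₀ := 3) (by simpa using h3)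
    hleast
  exact ⟨m, by simpa using hm⟩

end Summit.Ventures.HodgeRepro2.T5Sl2LowestWeightExists
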